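import Summits.Ventures.YMGap.RobustBall.BoundaryDecayBall
import Literature.Probability.LatticeModels.DobrushinComparisonDefectStates
import HarnessLib

/-!
# Venture YMGap, track ROBUST-BALL — ONE STATE AT A RATE, LOCALITY: a state that satisfies the member's DLR equations INSIDE a
# region agrees with the one state deep inside that region, exponentially in the depth — modifications of the action OUTSIDE
# a region, of ANY size, are felt inside only through an exponentially small tail

HONEST FRAMING. WHAT THIS IS: a venture file (cell `pub-ymgap`, track Y2 ROBUST-BALL, seat ds-3, theorems only), the
"arbitrary outside" strengthening of `BoundaryDecay.lean`. There the compared measure was the member's own kernel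
`γ^W_Λ(· | η)`; here it is ANY probability measure `ν` satisfying the member's SINGLE-LINK DLR equations at the links of a
finite set `Λ` (`ν ∘ γ^W_{x} = ν`, `x ∈ Λ`) — finite-volume states with free or any other boundary TERMS, DLR states of any
other action that coincides with the member's on the links of `Λ`, torus states read in a box, … . Mechanism: Föllmer's
Comparison Theorem (2.8) WITH DEFECTS (lit-1's `DobrushinMetric.abs_integral_sub_integral_le_of_defect`): the defect of `ν`
is `0` on `Λ` and at most the diameter `2√N` off `Λ`, and `d_x = (2√N/(1−ρ')) ρ'^{ℓ(x)}` with the depth profile `ℓ` of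
`BoundaryDecay.exists_depthProfile` is a super-solution of `b + C d ≤ d` (`ρ' = max(ρ, ½)`).
* `BoundaryDecay.abs_integral_siteAvg_sub_integral_le` (any specification; the trivial defect `≤ R δ_x`),
  `BoundaryDecay.integral_siteAvg_eq_of_bind_eq` (single-link DLR ⇒ zero defect);
* ★★ `abs_integral_sub_integral_le_of_localDLR` — from ANY robust single-link door (`IsKRContraction` of `perturbedYM`, rows
  `≤ ρ < 1`, range `R`): for every DLR state `μ` of the member, every probability measure `ν` with the member's single-link
  DLR equations on `Λ`, every Lipschitz cylinder `F` (constant `K`, links `Δ` at depth `≥ D` in `Λ`):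
  `|∫ F dν − ∫ F dμ| ≤ (2√N/(1 − ρ')) · K · #Δ · ρ'^{⌊D / max(1,R)⌋₊}`;
* ★★ `abs_integral_sub_integral_le_of_agree` — TWO MEMBERS WHOSE ONE-LINK HAMILTONIANS AGREE ON `Λ`
  (`hamiltonianIn W' supp' {x} = hamiltonianIn W supp {x}`, `x ∈ Λ`; `W'` continuous, locally finite, of ANY size): every
  DLR state of `W'` is within the same bound of every DLR state of the door member `W` on observables deep inside `Λ`;
* ★ `su2_abs_integral_sub_integral_le_of_localDLR` (`SU(2)`, sharp pair, on `MemBallZd ε₀ ε₁ R`, hypothesis-free) and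
  ★ `su2_wilson_localPerturbation_upTo_oneTwelfth`: `0 ≤ β_W ≤ 1/12`, `μ` any DLR state of `SU(2)` Wilson on `ℤ⁴`, `ν` any
  DLR state of the Wilson action plus ANY continuous finite-range perturbation whose terms avoid the links of `Λ`:
  `|∫ F dν − ∫ F dμ| ≤ 4√2 · K · #Δ · 2^{−⌊D⌋}`.
WHAT THIS IS NOT: strong-coupling LATTICE statements inside the single-link doors; nothing about the continuum limit or the
Clay Millennium problem.

References: H. Föllmer, LNM 1362 (1988), Ch. I, (2.2), Lemma (2.5), Comparison Theorem (2.8), (2.10); H.-O. Georgii (2011),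
Thm. 8.20, Remark 8.26; lit-1's `DobrushinComparisonDefectStates.lean`; the seat's `BoundaryDecay.lean`, `BoundaryDecayBall.lean`.
-/

noncomputable section

open MeasureTheory Filter Function ProbabilityTheory Real
open scoped NNReal
open Literature.Probability.LatticeModels
open Literature.Probability.LatticeModels.DobrushinMetric
open Literature.MathematicalPhysics.QuantumLattice
open Literature.MathematicalPhysics.QuantumFieldTheory hiding ZdEdge
open Summit.QuantumFields.BalabanUV.InfraRed.StrongCouplingPoincareDoorSUN (oneLinkPoincareSUN_two_sharp)

namespace Summit.Ventures.YMGap.RobustBall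

/-! ### Generic: the defect of an arbitrary measure, and zero defect from a single-link DLR equation -/

namespace BoundaryDecay

variable {V S : Type*} [MeasurableSpace S] {γ : Specification V S} {r : S → S → ℝ}

/-- **The trivial defect** (Föllmer 1988, Ch. I, (2.2)–(2.3)): for ANY probability measure `ν`, any site `x` and a bounded
measurable `f` with coordinatewise `r`-Lipschitz bound `δ`, `0 ≤ r ≤ R`: `|∫ γ_x f dν − ∫ f dν| ≤ R · δ_x(f)` — by properness
`γ_x f(σ) − f(σ)` is an average of `f(τ) − f(σ)` over `τ = σ` off `x`. [cite: Follmer1988, Ch. I (2.3)] -/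
theorem abs_integral_siteAvg_sub_integral_le (hγ : IsSpecification γ) {R : ℝ} (hrR : ∀ a b, r a b ≤ R) (x : V) {f : (V → S) → ℝ} (hfm : Measurable f) (hfb : ∃ M, ∀ σ, |f σ| ≤ M)
    {δ : V → ℝ} (hδ : IsLipBound r f δ) (ν : Measure (V → S)) [IsProbabilityMeasure ν] :
    |(∫ σ, siteAvg γ x f σ ∂ν) - ∫ σ, f σ ∂ν| ≤ R * δ x := by
  obtain ⟨M, hM⟩ := hfb
  have hpt : ∀ σ, |siteAvg γ x f σ - f σ| ≤ R * δ x := fun σ => by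
    haveI := hγ.isProbability {x} σ
    have hfi : Integrable f (γ {x} σ) := integrable_of_abs_le' hfm hM
    have e : siteAvg γ x f σ - f σ = ∫ τ, (f τ - f σ) ∂(γ {x} σ) := by
      rw [siteAvg, integral_sub hfi (integrable_const _), integral_const, smul_eq_mul, probReal_univ, one_mul]
    rw [e]
    have hae : ∀ᵐ τ ∂(γ {x} σ), ‖f τ - f σ‖ ≤ R * δ x := by
      filter_upwards [hγ.proper {x} σ] with τ hτ
      rw [Real.norm_eq_abs]
      calc |f τ - f σ| ≤ δ x * r (τ x) (σ x) := hδ.le x τ σ fun z hz => hτ z (by simpa using hz)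
        _ ≤ δ x * R := mul_le_mul_of_nonneg_left (hrR _ _) (hδ.nonneg x)
        _ = R * δ x := mul_comm _ _
    have h := norm_integral_le_of_norm_le_const hae
    simpa [Real.norm_eq_abs] using h
  have hsm : Measurable (siteAvg γ x f) := measurable_siteAvg hγ x hfm
  have hsi : Integrable (siteAvg γ x f) ν := integrable_of_abs_le' hsm (fun σ => abs_siteAvg_le hγ x hM σ)
  have hfi : Integrable f ν := integrable_of_abs_le' hfm hM
  rw [← integral_sub hsi hfi]
  have h := norm_integral_le_of_norm_le_const (μ := ν) (f := fun σ => siteAvg γ x f σ - f σ) (C := R * δ x)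
    (ae_of_all _ fun σ => by rw [Real.norm_eq_abs]; exact hpt σ)
  simpa [Real.norm_eq_abs] using h

/-- **Zero defect from a single-link DLR equation**: if `ν ∘ γ_{x} = ν` then `∫ γ_x f dν = ∫ f dν` for bounded measurable `f`
(Mathlib `Kernel.integral_comp`). [folklore] -/
theorem integral_siteAvg_eq_of_bind_eq (hγ : IsSpecification γ) {ν : Measure (V → S)} [IsProbabilityMeasure ν] {x : V}
    (hν : ν.bind (γ {x}) = ν) {f : (V → S) → ℝ} (hfm : Measurable f) (hfb : ∃ M, ∀ σ, |f σ| ≤ M) :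
    ∫ σ, siteAvg γ x f σ ∂ν = ∫ σ, f σ ∂ν := by
  obtain ⟨M, hM⟩ := hfb
  let κ : Kernel (V → S) (V → S) := ⟨γ {x}, hγ.measurable_fun {x}⟩
  have hcomp : (κ ∘ₖ Kernel.const Unit ν) () = ν := by
    rw [Kernel.comp_apply, Kernel.const_apply]
    exact hν
  have hfi : Integrable f ((κ ∘ₖ Kernel.const Unit ν) ()) := by
    rw [hcomp]; exact integrable_of_abs_le' hfm hM
  have key := Kernel.integral_comp hfi
  rw [hcomp, Kernel.const_apply] at key
  exact key.symm

end BoundaryDecay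

/-! ### The carrier: a locally-DLR measure against a DLR state of a door member -/

section Carrier

variable {d N : ℕ}

/-- ★★ **LOCALITY OF THE ONE STATE, from ANY robust single-link door.** Let `N β S_W + W` be a tier-1 member whose kernels form
a Kantorovich–Rubinstein contraction (`IsKRContraction`, finite neighbourhoods `perturbedNbr supp`, rows `≤ ρ < 1`, range
`R`), `μ` ANY of its DLR states, and `ν` ANY probability measure satisfying the member's single-link DLR equations at every
link of a finite set `Λ` (`ν ∘ γ^W_{x} = ν`, `x ∈ Λ`). Then for every Lipschitz cylinder `F` (constant `K`, links `Δ` whose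
base points are at `ℓ^∞`-distance `≥ D` from those of every link outside `Λ`), with `ρ' = max(ρ, ½)`:
`|∫ F dν − ∫ F dμ| ≤ (2√N/(1 − ρ')) · K · #Δ · ρ'^{⌊D / max(1,R)⌋₊}` (Föllmer (2.8) with defects `b = 2√N 𝟙_{Λᶜ}` and the
super-solution `(2√N/(1−ρ')) ρ'^{ℓ}`). [folklore] -/
theorem abs_integral_sub_integral_le_of_localDLR {β ρ R : ℝ}
    {W : Potential (ZdEdge d) (Matrix.specialUnitaryGroup (Fin N) ℂ)} (hW : W.IsAdapted)
    (hWb : ∀ X, ∃ C, ∀ U, |W X U| ≤ C)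
    {supp : Finset (ZdEdge d) → Finset (Finset (ZdEdge d))} (hsupp : W.IsSupportedBy supp)
    {C : ZdEdge d → ZdEdge d → ℝ}
    (hKR : IsKRContraction (perturbedYM (d := d) (fundamentalRep (Fin N)) (N * β) W supp) suFrobDist
      (perturbedNbr supp) C)
    (hrow : ∀ x, ∑ y ∈ perturbedNbr supp x, C x y ≤ ρ) (hρ : ρ < 1)
    (hR : ∀ e, ∀ X ∈ supp {e}, e ∈ X → ∀ y ∈ X, ‖e.1 - y.1‖ ≤ R)
    {μ : Measure (LGConfig d (Matrix.specialUnitaryGroup (Fin N) ℂ))}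
    (hμ : μ ∈ perturbedGibbsMeasures (d := d) (fundamentalRep (Fin N)) (N * β) W supp)
    (ν : Measure (LGConfig d (Matrix.specialUnitaryGroup (Fin N) ℂ))) [IsProbabilityMeasure ν] (Λ : Finset (ZdEdge d))
    (hν : ∀ x ∈ Λ, ν.bind (perturbedYM (d := d) (fundamentalRep (Fin N)) (N * β) W supp {x}) = ν)
    {F : LGConfig d (Matrix.specialUnitaryGroup (Fin N) ℂ) → ℝ} {Δ : Finset (ZdEdge d)} {K : ℝ≥0}
    (hF : IsLipschitzCylinder (fundamentalRep (Fin N)) F Δ K) {D : ℝ}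
    (hD : ∀ y ∈ Δ, ∀ z, z ∉ Λ → D ≤ ‖y.1 - z.1‖) :
    |(∫ U, F U ∂ν) - ∫ U, F U ∂μ| ≤
      2 * Real.sqrt N / (1 - max ρ (1 / 2)) * K * Δ.card * (max ρ (1 / 2)) ^ ⌊D / max 1 R⌋₊ := by
  classical
  have hγ : IsSpecification (perturbedYM (d := d) (fundamentalRep (Fin N)) (N * β) W supp) :=
    isSpecification_perturbedYM _ (continuous_fundamentalRep (Fin N)) _ hW hWb hsupp
  have hc'0 : 0 < max ρ (1 / 2) := lt_max_of_lt_right (by norm_num)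
  have hc'1 : max ρ (1 / 2) < 1 := max_lt hρ (by norm_num)
  have hrow' : ∀ x, ∑ y ∈ perturbedNbr supp x, C x y ≤ max ρ (1 / 2) := fun x => (hrow x).trans (le_max_left _ _)
  have hR₀0 : 0 < max 1 R := zero_lt_one.trans_le (le_max_left _ _)
  have hRsqrt : (0 : ℝ) ≤ 2 * Real.sqrt N := by positivity
  have hμ' : IsGibbsMeasure (perturbedYM (d := d) (fundamentalRep (Fin N)) (N * β) W supp) μ := hμ
  haveI := hμ'.isProbabilityMeasure
  have h1ρ : 0 < 1 - max ρ (1 / 2) := by linarith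
  have hA0 : 0 ≤ 2 * Real.sqrt N / (1 - max ρ (1 / 2)) := div_nonneg hRsqrt h1ρ.le
  -- the trivial case `Δ = ∅`: `F` is constant
  rcases Δ.eq_empty_or_nonempty with hΔ | hΔ
  · have hconst : ∀ U, F U = F 1 := fun U => hF.dependsOn (fun x hx => by simp [hΔ] at hx)
    simp only [hconst, integral_const, smul_eq_mul, probReal_univ, one_mul, sub_self, abs_zero, hΔ,
      Finset.card_empty, Nat.cast_zero, mul_zero, zero_mul, le_refl]
  obtain ⟨ℓ, hℓ0, hℓ1, hℓΔ⟩ := exists_depthProfile hR₀0 (fun x y hy => norm_sub_le_of_mem_perturbedNbr hR x hy) hΔ hD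
  -- the defect vector of `ν` and the super-solution
  have hdef : ∀ (x : ZdEdge d) (f : LGConfig d (Matrix.specialUnitaryGroup (Fin N) ℂ) → ℝ) (Δ' : Finset (ZdEdge d))
      (δ : ZdEdge d → ℝ), Measurable f → DependsOn f (↑Δ' : Set (ZdEdge d)) → (∃ M, ∀ σ, |f σ| ≤ M) →
      IsLipBound suFrobDist f δ →
        |(∫ σ, siteAvg (perturbedYM (d := d) (fundamentalRep (Fin N)) (N * β) W supp) x f σ ∂ν) - ∫ σ, f σ ∂ν| ≤
          (if x ∈ Λ then 0 else 2 * Real.sqrt N) * δ x := by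
    intro x f Δ' δ hfm _ hfb hδ
    by_cases hx : x ∈ Λ
    · rw [if_pos hx, zero_mul, BoundaryDecay.integral_siteAvg_eq_of_bind_eq hγ (hν x hx) hfm hfb, sub_self, abs_zero]
    · rw [if_neg hx]
      exact BoundaryDecay.abs_integral_siteAvg_sub_integral_le hγ suFrobDist_le x hfm hfb hδ ν
  have hsuper : ∀ x, (if x ∈ Λ then 0 else 2 * Real.sqrt N) +
      (∑ y ∈ perturbedNbr supp x, C x y * (2 * Real.sqrt N / (1 - max ρ (1 / 2)) * max ρ (1 / 2) ^ ℓ y)) ≤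
        2 * Real.sqrt N / (1 - max ρ (1 / 2)) * max ρ (1 / 2) ^ ℓ x := by
    intro x
    by_cases hx : x ∈ Λ
    · rw [if_pos hx, zero_add]
      have hle : ∀ y ∈ perturbedNbr supp x, C x y * (2 * Real.sqrt N / (1 - max ρ (1 / 2)) * max ρ (1 / 2) ^ ℓ y) ≤
          C x y * (2 * Real.sqrt N / (1 - max ρ (1 / 2)) * max ρ (1 / 2) ^ (ℓ x - 1)) := fun y hy =>
        mul_le_mul_of_nonneg_left (mul_le_mul_of_nonneg_left
          (pow_le_pow_of_le_one hc'0.le hc'1.le (by have := hℓ1 x hx y hy; omega)) hA0) (hKR.nonneg x y)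
      calc ∑ y ∈ perturbedNbr supp x, C x y * (2 * Real.sqrt N / (1 - max ρ (1 / 2)) * max ρ (1 / 2) ^ ℓ y)
          ≤ ∑ y ∈ perturbedNbr supp x, C x y * (2 * Real.sqrt N / (1 - max ρ (1 / 2)) * max ρ (1 / 2) ^ (ℓ x - 1)) :=
            Finset.sum_le_sum hle
        _ = (∑ y ∈ perturbedNbr supp x, C x y) * (2 * Real.sqrt N / (1 - max ρ (1 / 2)) * max ρ (1 / 2) ^ (ℓ x - 1)) := by
            rw [Finset.sum_mul]
        _ ≤ max ρ (1 / 2) * (2 * Real.sqrt N / (1 - max ρ (1 / 2)) * max ρ (1 / 2) ^ (ℓ x - 1)) :=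
            mul_le_mul_of_nonneg_right (hrow' x) (mul_nonneg hA0 (pow_nonneg hc'0.le _))
        _ ≤ 2 * Real.sqrt N / (1 - max ρ (1 / 2)) * max ρ (1 / 2) ^ ℓ x := by
            rcases Nat.eq_zero_or_pos (ℓ x) with h0 | hpos
            · rw [h0, Nat.zero_sub, pow_zero, mul_one]
              exact mul_le_of_le_one_left hA0 hc'1.le
            · rw [show max ρ (1 / 2) ^ ℓ x = max ρ (1 / 2) * max ρ (1 / 2) ^ (ℓ x - 1) by
                rw [← pow_succ', Nat.sub_add_cancel hpos]]
              exact le_of_eq (by ring)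
    · rw [if_neg hx, hℓ0 x hx, pow_zero, mul_one]
      have hle : ∀ y ∈ perturbedNbr supp x, C x y * (2 * Real.sqrt N / (1 - max ρ (1 / 2)) * max ρ (1 / 2) ^ ℓ y) ≤
          C x y * (2 * Real.sqrt N / (1 - max ρ (1 / 2))) := fun y hy =>
        mul_le_mul_of_nonneg_left (mul_le_of_le_one_right hA0 (pow_le_one₀ hc'0.le hc'1.le)) (hKR.nonneg x y)
      calc 2 * Real.sqrt N + ∑ y ∈ perturbedNbr supp x, C x y * (2 * Real.sqrt N / (1 - max ρ (1 / 2)) * max ρ (1 / 2) ^ ℓ y)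
          ≤ 2 * Real.sqrt N + (∑ y ∈ perturbedNbr supp x, C x y) * (2 * Real.sqrt N / (1 - max ρ (1 / 2))) := by
            rw [Finset.sum_mul]; exact add_le_add le_rfl (Finset.sum_le_sum hle)
        _ ≤ 2 * Real.sqrt N + max ρ (1 / 2) * (2 * Real.sqrt N / (1 - max ρ (1 / 2))) :=
            add_le_add le_rfl (mul_le_mul_of_nonneg_right (hrow' x) hA0)
        _ = 2 * Real.sqrt N / (1 - max ρ (1 / 2)) := by
            have hne : 1 - max ρ (1 / 2) ≠ 0 := h1ρ.ne'
            field_simp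
            ring
  have key := abs_integral_sub_integral_le_of_defect hγ hKR (fun _ _ => suFrobDist_nonneg _ _) suFrobDist_le hRsqrt
    hc'0.le hc'1 hrow' hμ' (ν := ν) (b := fun x => if x ∈ Λ then 0 else 2 * Real.sqrt N)
    (fun y => ite_nonneg le_rfl hRsqrt) hdef
    (d := fun x => 2 * Real.sqrt N / (1 - max ρ (1 / 2)) * max ρ (1 / 2) ^ ℓ x)
    (fun y => mul_nonneg hA0 (pow_nonneg hc'0.le _)) hsuper hF.measurable hF.dependsOn hF.abs_le
    (hF.isLipBound zero_le_one (fun a b => by rw [one_mul]; exact dist_suEntries_le_suFrobDist a b))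
  beta_reduce at key
  rw [abs_sub_comm]
  refine key.trans (le_of_eq ?_)
  calc ∑ y ∈ Δ, 2 * Real.sqrt N / (1 - max ρ (1 / 2)) * max ρ (1 / 2) ^ ℓ y * (if y ∈ Δ then 1 * (K : ℝ) else 0)
      = ∑ y ∈ Δ, 2 * Real.sqrt N / (1 - max ρ (1 / 2)) * max ρ (1 / 2) ^ ⌊D / max 1 R⌋₊ * K :=
        Finset.sum_congr rfl fun y hy => by rw [if_pos hy, one_mul, hℓΔ y hy]
    _ = 2 * Real.sqrt N / (1 - max ρ (1 / 2)) * K * Δ.card * (max ρ (1 / 2)) ^ ⌊D / max 1 R⌋₊ := by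
        rw [Finset.sum_const, nsmul_eq_mul]; ring

/-- ★★ **TWO MEMBERS WHOSE ONE-LINK HAMILTONIANS AGREE ON `Λ`.** Let `(W, supp)` be a door member as above with DLR state `μ`,
and `(W', supp')` ANY tier-1 member (continuous terms reading their own links, locally finite support — no smallness) with
`hamiltonianIn W' supp' {x} = hamiltonianIn W supp {x}` for every `x ∈ Λ` (the two actions have the same single-link
conditional laws on `Λ`; e.g. `W' − W` consists of terms avoiding the links of `Λ`). Then EVERY DLR state `ν` of `W'` satisfies
`|∫ F dν − ∫ F dμ| ≤ (2√N/(1 − ρ')) · K · #Δ · ρ'^{⌊D / max(1,R)⌋₊}` on Lipschitz cylinders at depth `≥ D` in `Λ` — a change of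
the action outside a region is felt inside only through an exponentially small tail. [folklore] -/
theorem abs_integral_sub_integral_le_of_agree {β ρ R : ℝ}
    {W : Potential (ZdEdge d) (Matrix.specialUnitaryGroup (Fin N) ℂ)} (hW : W.IsAdapted)
    (hWb : ∀ X, ∃ C, ∀ U, |W X U| ≤ C)
    {supp : Finset (ZdEdge d) → Finset (Finset (ZdEdge d))} (hsupp : W.IsSupportedBy supp)
    {C : ZdEdge d → ZdEdge d → ℝ}
    (hKR : IsKRContraction (perturbedYM (d := d) (fundamentalRep (Fin N)) (N * β) W supp) suFrobDist
      (perturbedNbr supp) C)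
    (hrow : ∀ x, ∑ y ∈ perturbedNbr supp x, C x y ≤ ρ) (hρ : ρ < 1)
    (hR : ∀ e, ∀ X ∈ supp {e}, e ∈ X → ∀ y ∈ X, ‖e.1 - y.1‖ ≤ R)
    {μ : Measure (LGConfig d (Matrix.specialUnitaryGroup (Fin N) ℂ))}
    (hμ : μ ∈ perturbedGibbsMeasures (d := d) (fundamentalRep (Fin N)) (N * β) W supp)
    {W' : Potential (ZdEdge d) (Matrix.specialUnitaryGroup (Fin N) ℂ)} (hW'c : ∀ X, Continuous (W' X))
    (hW'dep : ∀ X, DependsOn (W' X) (↑X : Set (ZdEdge d)))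
    {supp' : Finset (ZdEdge d) → Finset (Finset (ZdEdge d))} (hsupp' : W'.IsSupportedBy supp')
    {ν : Measure (LGConfig d (Matrix.specialUnitaryGroup (Fin N) ℂ))}
    (hν : ν ∈ perturbedGibbsMeasures (d := d) (fundamentalRep (Fin N)) (N * β) W' supp') (Λ : Finset (ZdEdge d))
    (hagree : ∀ x ∈ Λ, hamiltonianIn W' supp' {x} = hamiltonianIn W supp {x})
    {F : LGConfig d (Matrix.specialUnitaryGroup (Fin N) ℂ) → ℝ} {Δ : Finset (ZdEdge d)} {K : ℝ≥0}
    (hF : IsLipschitzCylinder (fundamentalRep (Fin N)) F Δ K) {D : ℝ}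
    (hD : ∀ y ∈ Δ, ∀ z, z ∉ Λ → D ≤ ‖y.1 - z.1‖) :
    |(∫ U, F U ∂ν) - ∫ U, F U ∂μ| ≤
      2 * Real.sqrt N / (1 - max ρ (1 / 2)) * K * Δ.card * (max ρ (1 / 2)) ^ ⌊D / max 1 R⌋₊ := by
  have hγ' : IsSpecification (perturbedYM (d := d) (fundamentalRep (Fin N)) (N * β) W' supp') :=
    isSpecification_perturbedYM _ (continuous_fundamentalRep (Fin N)) _ (fun X => ⟨hW'dep X, (hW'c X).measurable⟩)
      (fun X => exists_bound_of_continuous (hW'c X)) hsupp'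
  have hν' : IsGibbsMeasure (perturbedYM (d := d) (fundamentalRep (Fin N)) (N * β) W' supp') ν := hν
  haveI := hν'.isProbabilityMeasure
  refine abs_integral_sub_integral_le_of_localDLR hW hWb hsupp hKR hrow hρ hR hμ ν Λ (fun x hx => ?_) hF hD
  have eE : perturbedEnergy (d := d) (fundamentalRep (Fin N)) (N * β) W supp {x} =
      perturbedEnergy (d := d) (fundamentalRep (Fin N)) (N * β) W' supp' {x} := by
    funext U
    simp only [perturbedEnergy, hagree x hx]
  have e : perturbedYM (d := d) (fundamentalRep (Fin N)) (N * β) W supp {x} =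
      perturbedYM (d := d) (fundamentalRep (Fin N)) (N * β) W' supp' {x} := by
    funext η
    simp only [perturbedYM, eE]
  rw [e]
  exact hν'.bind_eq hγ' {x}

end Carrier

/-! ### `SU(2)`, hypothesis-free (sharp pair), and the Wilson point -/

section SU2

variable {d : ℕ}

/-- ★ **`SU(2)`, HYPOTHESIS-FREE, every `d ≥ 1`, ON THE BALL `MemBallZd ε₀ ε₁ R`** (Wilson units, 't Hooft `β_W/4`): if
`2(d−1)|β_W| e^{ε₀} + e^{ε₀/2} √(2/3) ε₁ ≤ ρ < 1` then for every member `(W, supp)`, every DLR state `μ`, every probability measure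
`ν` with the member's single-link DLR equations on `Λ`, and every Lipschitz cylinder at depth `≥ D` in `Λ`:
`|∫ F dν − ∫ F dμ| ≤ (2√2/(1 − ρ')) · K · #Δ · ρ'^{⌊D / max(1,R)⌋₊}`, `ρ' = max(ρ, ½)`. [folklore] -/
theorem su2_abs_integral_sub_integral_le_of_localDLR (hd : 1 ≤ d) {βW ε₀ ε₁ ρ R : ℝ}
    (hρ : 2 * ((d : ℝ) - 1) * |βW| * exp ε₀ + exp (ε₀ / 2) * Real.sqrt (2 / 3) * ε₁ ≤ ρ) (hρ1 : ρ < 1)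
    {W : Potential (ZdEdge d) (Matrix.specialUnitaryGroup (Fin 2) ℂ)}
    {supp : Finset (ZdEdge d) → Finset (Finset (ZdEdge d))} (hmem : MemBallZd ε₀ ε₁ R W supp)
    {μ : Measure (LGConfig d (Matrix.specialUnitaryGroup (Fin 2) ℂ))}
    (hμ : μ ∈ perturbedGibbsMeasures (d := d) (fundamentalRep (Fin 2)) ((2 : ℕ) * (βW / 4)) W supp)
    (ν : Measure (LGConfig d (Matrix.specialUnitaryGroup (Fin 2) ℂ))) [IsProbabilityMeasure ν] (Λ : Finset (ZdEdge d))
    (hν : ∀ x ∈ Λ, ν.bind (perturbedYM (d := d) (fundamentalRep (Fin 2)) ((2 : ℕ) * (βW / 4)) W supp {x}) = ν)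
    {F : LGConfig d (Matrix.specialUnitaryGroup (Fin 2) ℂ) → ℝ} {Δ : Finset (ZdEdge d)} {K : ℝ≥0}
    (hF : IsLipschitzCylinder (fundamentalRep (Fin 2)) F Δ K) {D : ℝ}
    (hD : ∀ y ∈ Δ, ∀ z, z ∉ Λ → D ≤ ‖y.1 - z.1‖) :
    |(∫ U, F U ∂ν) - ∫ U, F U ∂μ| ≤
      2 * Real.sqrt 2 / (1 - max ρ (1 / 2)) * K * Δ.card * (max ρ (1 / 2)) ^ ⌊D / max 1 R⌋₊ := by
  haveI : SecondCountableTopology (Matrix (Fin 2) (Fin 2) ℂ) :=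
    inferInstanceAs (SecondCountableTopology (Fin 2 → Fin 2 → ℂ))
  haveI : SecondCountableTopology (Matrix.specialUnitaryGroup (Fin 2) ℂ) :=
    Topology.IsEmbedding.subtypeVal.secondCountableTopology
  have hc : (0 : ℝ) ≤ 2 / 3 := by norm_num
  have hP : ∀ B : Matrix (Fin 2) (Fin 2) ℂ, matrixOpNorm B ≤ |βW / 4| * (2 * ((d : ℝ) - 1)) →
      ∀ (ψ : Matrix.specialUnitaryGroup (Fin 2) ℂ → ℝ) (M : ℝ), 0 ≤ M →
        (∀ x y, |ψ x - ψ y| ≤ M * suFrobDist x y) →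
        Var[ψ; (haarProbability (Matrix.specialUnitaryGroup (Fin 2) ℂ)).tilted
          fun g => ((2 : ℕ) : ℝ) * ((g : Matrix (Fin 2) (Fin 2) ℂ) * B).trace.re] ≤ 2 / 3 * M ^ 2 :=
    fun B hB ψ M hM hψ => oneLinkPoincareSUN_two_sharp _ B hB ψ M hM hψ
  have hVB := linVariance_of_poincare (N := 2) hP
  have hv : (0 : ℝ) ≤ 2 / 3 * ((2 : ℕ) : ℝ) ^ 2 := by norm_num
  have hsq : Real.sqrt (2 / 3 * (2 / 3 * ((2 : ℕ) : ℝ) ^ 2)) = 4 / 3 := by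
    rw [show (2 / 3 * (2 / 3 * ((2 : ℕ) : ℝ) ^ 2) : ℝ) = (4 / 3) ^ 2 by norm_num, Real.sqrt_sq (by norm_num)]
  obtain ⟨osc, lip, hosc, hlip, hosca, hΛ⟩ := hmem.loads
  have hW : W.IsAdapted := fun X => ⟨hmem.dependsOn X, (hmem.continuous X).measurable⟩
  have hWb : ∀ X, ∃ C, ∀ U, |W X U| ≤ C := fun X => exists_bound_of_continuous (hmem.continuous X)
  have hKR := isKRContraction_perturbedYM_SU hd (by norm_num : 1 ≤ 2) hc hv (le_refl (|βW / 4| * (2 * ((d : ℝ) - 1))))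
    hP hVB hW (supp := supp) hosc hosca hlip
  have hrow : ∀ x, ∑ y ∈ perturbedNbr supp x,
      (exp ε₀ * Real.sqrt (2 / 3 * (2 / 3 * ((2 : ℕ) : ℝ) ^ 2)) * |βW / 4| * linkInfluence x y +
        exp (ε₀ / 2) * Real.sqrt (2 / 3) * ∑ X ∈ (supp {x}).filter (fun X => x ∈ X), lip X y) ≤ ρ := by
    intro x
    refine (sum_perturbedNbr_coeff_le hd (β := βW / 4) (c := 2 / 3) (v := 2 / 3 * ((2 : ℕ) : ℝ) ^ 2) (a := ε₀) hΛ x).trans ?_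
    rw [hsq]
    have e : 6 * ((d : ℝ) - 1) * |βW / 4| * (exp ε₀ * (4 / 3)) = 2 * ((d : ℝ) - 1) * |βW| * exp ε₀ := by
      rw [abs_div, abs_of_pos (by norm_num : (0 : ℝ) < 4)]
      ring
    rw [e]
    exact hρ
  have h := abs_integral_sub_integral_le_of_localDLR hW hWb hmem.supportedBy hKR hrow hρ1 hmem.range hμ ν Λ hν hF hD
  have e2 : Real.sqrt ((2 : ℕ) : ℝ) = Real.sqrt 2 := by norm_num
  rw [e2] at h
  exact h

/-- ★ **THE WILSON POINT, LOCAL PERTURBATIONS OF ANY SIZE OUTSIDE A REGION**: let `0 ≤ β_W ≤ 1/12`, `μ` ANY DLR state of `SU(2)`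
lattice Yang–Mills on `ℤ⁴` (tree coupling `β_W/2`), `(W', supp')` ANY continuous finite-range perturbation (terms reading their
own links, locally finite support, NO smallness) whose one-link Hamiltonians vanish on the links of `Λ`
(`hamiltonianIn W' supp' {x} = 0`, `x ∈ Λ`: no term of `W'` through a link of `Λ`), and `ν` ANY DLR state of
`(β_W/2) S_W + W'`. Then for every Lipschitz cylinder `F` (constant `K`, links `Δ` at depth `≥ D` in `Λ`):
`|∫ F dν − ∫ F dμ| ≤ 4√2 · K · #Δ · (1/2)^{⌊D⌋₊}`. [folklore] -/
theorem su2_wilson_localPerturbation_upTo_oneTwelfth {βW : ℝ} (h0 : 0 ≤ βW) (h : βW ≤ 1 / 12)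
    {μ : Measure (LGConfig 4 (Matrix.specialUnitaryGroup (Fin 2) ℂ))}
    (hμ : μ ∈ ymGibbsMeasures (d := 4) (fundamentalRep (Fin 2)) (βW / 2))
    {W' : Potential (ZdEdge 4) (Matrix.specialUnitaryGroup (Fin 2) ℂ)} (hW'c : ∀ X, Continuous (W' X))
    (hW'dep : ∀ X, DependsOn (W' X) (↑X : Set (ZdEdge 4)))
    {supp' : Finset (ZdEdge 4) → Finset (Finset (ZdEdge 4))} (hsupp' : W'.IsSupportedBy supp')
    {ν : Measure (LGConfig 4 (Matrix.specialUnitaryGroup (Fin 2) ℂ))}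
    (hν : ν ∈ perturbedGibbsMeasures (d := 4) (fundamentalRep (Fin 2)) (βW / 2) W' supp') (Λ : Finset (ZdEdge 4))
    (hfree : ∀ x ∈ Λ, hamiltonianIn W' supp' {x} = 0)
    {F : LGConfig 4 (Matrix.specialUnitaryGroup (Fin 2) ℂ) → ℝ} {Δ : Finset (ZdEdge 4)} {K : ℝ≥0}
    (hF : IsLipschitzCylinder (fundamentalRep (Fin 2)) F Δ K) {D : ℝ}
    (hD : ∀ y ∈ Δ, ∀ z, z ∉ Λ → D ≤ ‖y.1 - z.1‖) :
    |(∫ U, F U ∂ν) - ∫ U, F U ∂μ| ≤ 4 * Real.sqrt 2 * K * Δ.card * (1 / 2 : ℝ) ^ ⌊D⌋₊ := by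
  haveI : SecondCountableTopology (Matrix (Fin 2) (Fin 2) ℂ) :=
    inferInstanceAs (SecondCountableTopology (Fin 2 → Fin 2 → ℂ))
  haveI : SecondCountableTopology (Matrix.specialUnitaryGroup (Fin 2) ℂ) :=
    Topology.IsEmbedding.subtypeVal.secondCountableTopology
  have hβ : (((2 : ℕ) : ℝ) * (βW / 4) : ℝ) = βW / 2 := by push_cast; ring
  set supp₀ : Finset (ZdEdge 4) → Finset (Finset (ZdEdge 4)) := fun _ => ∅ with hsupp₀
  have hmem : MemBallZd (N := 2) (0 : ℝ) 0 0 (0 : Potential (ZdEdge 4) (Matrix.specialUnitaryGroup (Fin 2) ℂ)) supp₀ :=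
    memBallZd_zero le_rfl le_rfl fun _ _ h => by simp [hsupp₀] at h
  have hμ' : μ ∈ perturbedGibbsMeasures (d := 4) (fundamentalRep (Fin 2)) ((2 : ℕ) * (βW / 4)) 0 supp₀ := by
    rwa [perturbedGibbsMeasures_zero, hβ]
  -- the door data of the zero member (sharp pair), as in `su2_abs_integral_sub_integral_le_of_localDLR`
  have hc : (0 : ℝ) ≤ 2 / 3 := by norm_num
  have hP : ∀ B : Matrix (Fin 2) (Fin 2) ℂ, matrixOpNorm B ≤ |βW / 4| * (2 * (((4 : ℕ) : ℝ) - 1)) →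
      ∀ (ψ : Matrix.specialUnitaryGroup (Fin 2) ℂ → ℝ) (M : ℝ), 0 ≤ M →
        (∀ x y, |ψ x - ψ y| ≤ M * suFrobDist x y) →
        Var[ψ; (haarProbability (Matrix.specialUnitaryGroup (Fin 2) ℂ)).tilted
          fun g => ((2 : ℕ) : ℝ) * ((g : Matrix (Fin 2) (Fin 2) ℂ) * B).trace.re] ≤ 2 / 3 * M ^ 2 :=
    fun B hB ψ M hM hψ => oneLinkPoincareSUN_two_sharp _ B hB ψ M hM hψ
  have hVB := linVariance_of_poincare (N := 2) hP
  have hv : (0 : ℝ) ≤ 2 / 3 * ((2 : ℕ) : ℝ) ^ 2 := by norm_num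
  have hsq : Real.sqrt (2 / 3 * (2 / 3 * ((2 : ℕ) : ℝ) ^ 2)) = 4 / 3 := by
    rw [show (2 / 3 * (2 / 3 * ((2 : ℕ) : ℝ) ^ 2) : ℝ) = (4 / 3) ^ 2 by norm_num, Real.sqrt_sq (by norm_num)]
  obtain ⟨osc, lip, hosc, hlip, hosca, hΛ⟩ := hmem.loads
  have hW : (0 : Potential (ZdEdge 4) (Matrix.specialUnitaryGroup (Fin 2) ℂ)).IsAdapted :=
    fun X => ⟨hmem.dependsOn X, (hmem.continuous X).measurable⟩
  have hWb : ∀ X, ∃ C, ∀ U, |(0 : Potential (ZdEdge 4) (Matrix.specialUnitaryGroup (Fin 2) ℂ)) X U| ≤ C :=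
    fun X => exists_bound_of_continuous (hmem.continuous X)
  have hKR := isKRContraction_perturbedYM_SU (d := 4) (by norm_num) (by norm_num : 1 ≤ 2) hc hv
    (le_refl (|βW / 4| * (2 * (((4 : ℕ) : ℝ) - 1)))) hP hVB hW (supp := supp₀) hosc hosca hlip
  have hrow : ∀ x, ∑ y ∈ perturbedNbr supp₀ x,
      (exp 0 * Real.sqrt (2 / 3 * (2 / 3 * ((2 : ℕ) : ℝ) ^ 2)) * |βW / 4| * linkInfluence x y +
        exp (0 / 2) * Real.sqrt (2 / 3) * ∑ X ∈ (supp₀ {x}).filter (fun X => x ∈ X), lip X y) ≤ 1 / 2 := by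
    intro x
    refine (sum_perturbedNbr_coeff_le (d := 4) (by norm_num) (β := βW / 4) (c := 2 / 3) (v := 2 / 3 * ((2 : ℕ) : ℝ) ^ 2)
      (a := 0) hΛ x).trans ?_
    rw [hsq, abs_div, abs_of_pos (by norm_num : (0 : ℝ) < 4), abs_of_nonneg h0, Real.exp_zero, zero_div, Real.exp_zero]
    norm_num
    linarith
  have key := abs_integral_sub_integral_le_of_agree (ρ := 1 / 2) hW hWb hmem.supportedBy hKR hrow (by norm_num) hmem.range hμ'
    hW'c hW'dep hsupp' (ν := ν) (by rwa [hβ]) Λ (fun x hx => by rw [hfree x hx]; funext σ; simp [hamiltonianIn, hsupp₀]) hF hD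
  have e2 : Real.sqrt ((2 : ℕ) : ℝ) = Real.sqrt 2 := by norm_num
  rw [e2, max_self, max_eq_left (zero_le_one : (0 : ℝ) ≤ 1), div_one] at key
  refine key.trans (le_of_eq ?_)
  ring

end SU2

end Summit.Ventures.YMGap.RobustBall

end
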